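import Summits.HodgeConjecture.CorCM.MumfordTateLieAlgebraOfCMType
import Summits.HodgeConjecture.CorCM.EndAlgebraCenterStructure
import Literature.AlgebraicGeometry.Motives.HodgeLieWeightOneRankThree
import Literature.AlgebraicGeometry.ComplexMultiplication.CenterEndAlgebraTotallyRealOrCMOfRiemann
import Literature.AlgebraicGeometry.HodgeTheory.BettiOneHodgeStructureModelIndependence
import HarnessLib

/-!
# The rung `dim MT(H¹(X)) = 4` of the Mumford–Tate rank ladder for complex abelian varieties NOT of CM type:
# `End⁰(X)` is a central `ℚ`-algebra of dimension `(dim X)²` and `X` is isotypic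

COR-CM (cell `pub-hodgecm2`, seat `b27` gen 30, count-neutral lane MT-RANK-FOUR; theorems only, no definition, no
named fact; UNCONDITIONAL).  Sequel of `CorCM/MumfordTateRankThree` (gen 29: `dim MT(H¹(X)) ≤ 3 ⟹ X` of CM type;
non-CM `⟹ dim MT ≥ 4`).  Here the boundary value `4` for NON-CM abelian varieties: for a complex abelian variety `X`
with `0 < dim X`, NOT of CM type, and `dim MT(H¹(X)) ≤ 4` (then `= 4`):

* §1 (bridge) `finrank_endAlgebra_eq_finrank_endAlg` — `dim_ℚ End⁰(X) = dim_ℚ End_Hdg(H¹(X))` (Riemann: the rational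
  representation `bettiRep` is injective with image `End_Hdg`, `deligneMilne1982_Thm_6_20_full_holds`), and
  `mem_bot_of_mem_center_endAlgebra` — transport of centres: if central Hodge endomorphisms of `H¹(X)` are rational
  scalars then `Z(End⁰(X)) = ℚ`.
* §2 **`finrank_endAlgebra_eq_dim_sq_of_not_isOfCMType`** — `dim_ℚ End⁰(X) = (dim X)²`, `dim MT(H¹(X)) = 4`,
  `dim Hg(H¹(X)) = 3`; **`center_endAlgebra_eq_bot_of_not_isOfCMType`** — the centre of `End⁰(X)` is `ℚ`
  (`Motives/HodgeLieWeightOneRankThree`: `End_Hdg(H¹X) ⊗ ℂ ≅ M_g(ℂ)`).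
* §3 **`exists_isIsogenous_power_of_not_isOfCMType`** — `X ∼ B^{m+1}` for ONE simple `B` (not of CM type) with
  `dim_ℚ End⁰(B) · (m+1)² = (dim X)²`, `dim X = (m+1) dim B` and `Z(End⁰(B)) = ℚ` (the centre of `End⁰` of the
  isotypic decomposition `⨁ᵢ Bᵢ^{nᵢ+1}` has dimension `Σᵢ dim Z(End⁰ Bᵢ) ≥ #{i}`, `CorCM/EndAlgebraCenterStructure`).
  Classically `B` is a non-CM elliptic curve (`End⁰ = ℚ`) or an abelian surface with quaternionic multiplication
  (Moonen–Zarhin 1999 §2; Albert), the abelian varieties with `Hg = SL₂`; Albert's classification is not in the tree.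
* §4 `mtRank_hodge_one_le_sq` — `dim MT(H¹(X)) ≤ (2 dim X)²` for every `X`; hence **`mtRank_hodge_one_eq_four_of_dim_one`**:
  a NON-CM ELLIPTIC CURVE has `dim MT(H¹(E)) = 4` (`= GL₂`), and `finrank_endAlgebra_eq_one_of_dim_one`: `End⁰(E) = ℚ`.

## References

* [MoonenZarhin1999LowDim] B. Moonen, Yu. Zarhin, *Hodge classes on abelian varieties of low dimension*, Math. Ann.
  315 (1999), §2 (`MT = 𝔾ₘ·Hg`, `End⁰(X) = End_{Hg}(H¹)`, `X` of CM type iff `Hg` commutative; (2.3)–(2.5)).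
* [Deligne1982HodgeCycles] P. Deligne, *Hodge cycles on abelian varieties*, LNM 900 (1982), I §3, §5 Prop. 5.1.
* [MumfordAV1970] D. Mumford, *Abelian Varieties* (1970), §19 Thm. 1 Cor. 1–2 and p. 174 (`End⁰` of `∏ Aᵢ^{nᵢ}`).
* [DeligneMilne1982Tannakian] P. Deligne, J. S. Milne, *Tannakian Categories*, LNM 900 (1982), II Thm. 6.20 (Riemann).
-/

noncomputable section

open scoped TensorProduct
open CategoryTheory CategoryTheory.Limits Module

namespace Summit.HodgeConjecture.CorCM

open Literature.AlgebraicGeometry.Motives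
open Literature.AlgebraicGeometry.Motives.AbelianVariety
open Literature.AlgebraicGeometry.Motives.HodgeStructure
open Literature.AlgebraicGeometry.HodgeTheory
open Literature.AlgebraicGeometry.ComplexMultiplication (bettiRep bettiRep_injective bettiRep_of unop_bettiRep_mem_endAlg
  nontrivial_endAlgebra_of_dim_pos)
open Literature.AlgebraicGeometry.Milne1999 (IsOfCMType isOfCMType_iff_of_isIsogenous)

/-! ## §1 The bridge `End⁰(X) ≅ End_Hdg(H¹(X))` (Riemann): dimensions and centres -/

section Bridge

variable [HodgeTensorFacts.{0, 0}] {X : AbelianVariety ℂ} {n : ℕ}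

omit [HodgeTensorFacts.{0, 0}] in
/-- **`dim_ℚ End⁰(X) = dim_ℚ End_Hdg(H¹(X))`** for every complex abelian variety: the rational representation
`End⁰(X) → End_ℚ H¹(X(ℂ); ℚ)ᵐᵒᵖ` (`bettiRep`) is injective, lands in `End_Hdg` (`unop_bettiRep_mem_endAlg`) and is onto
`End_Hdg` by Riemann's theorem (`exists_hom_bettiMap_eq_smul_of_mem_endAlg`: `u^* = k • a`).
[cite: DeligneMilne1982Tannakian, II §6 Thm. 6.20] [cite: MoonenZarhin1999LowDim, §2 (End⁰(X) = End_{Hg} H¹)] -/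
theorem finrank_endAlgebra_eq_finrank_endAlg (hX : IsSmoothProjective n X.X) :
    haveI := BettiUniverse.finite hX 1
    Module.finrank ℚ X.endAlgebra =
      Module.finrank ℚ (BettiUniverse.hodge exists_isReal_hodgeModel_holds hX 1).endAlg := by
  have hn : X.dim = n := schemeDim_eq_holds hX
  subst hn
  haveI := BettiUniverse.finite hX 1
  set H := BettiUniverse.hodge exists_isReal_hodgeModel_holds hX 1 with hH
  -- the `ℚ`-linear map `ξ ↦ ξ^*`
  let ρ : X.endAlgebra →ₗ[ℚ] Module.End ℚ (bettiCohomology X.X 1) :=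
    (MulOpposite.opLinearEquiv ℚ (M := Module.End ℚ (bettiCohomology X.X 1))).symm.toLinearMap ∘ₗ
      (bettiRep X).toLinearMap
  have hρ : ∀ ξ, ρ ξ = MulOpposite.unop (bettiRep X ξ) := fun ξ => rfl
  have hinj : Function.Injective ρ := fun ξ ξ' h => by
    rw [hρ, hρ] at h
    exact bettiRep_injective (MulOpposite.unop_injective h)
  have hrange : LinearMap.range ρ = Subalgebra.toSubmodule H.endAlg := by
    apply le_antisymm
    · rintro _ ⟨ξ, rfl⟩
      rw [hρ]
      exact unop_bettiRep_mem_endAlg exists_isReal_hodgeModel_holds hodgePQ_independent_of_hodgeModel_holds ξ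
    · intro a ha
      rw [Subalgebra.mem_toSubmodule] at ha
      obtain ⟨u, k, hk, hu⟩ := exists_hom_bettiMap_eq_smul_of_mem_endAlg hX ha
      refine ⟨algebraMap ℚ X.endAlgebra ((k : ℚ)⁻¹) * AbelianVariety.endAlgebra.of X (End.of u), ?_⟩
      rw [hρ, map_mul, AlgHom.commutes, bettiRep_of, Algebra.algebraMap_eq_smul_one, smul_mul_assoc, one_mul,
        MulOpposite.unop_smul, MulOpposite.unop_op]
      change (k : ℚ)⁻¹ • (bettiCohomology.map u.hom.hom.hom 1).hom = a
      rw [hu, smul_smul, inv_mul_cancel₀ (by exact_mod_cast hk.ne'), one_smul]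
  rw [← LinearMap.finrank_range_of_inj hinj, hrange, Subalgebra.finrank_toSubmodule]

omit [HodgeTensorFacts.{0, 0}] in
/-- **Transport of centres**: if `z ∈ End⁰(X)` is central in `End⁰(X)` then `z^*` is a Hodge endomorphism commuting
with all of `End_Hdg(H¹(X))` (every Hodge endomorphism is `k⁻¹ u^*`, Riemann), so whenever central Hodge
endomorphisms are rational scalars, `z ∈ ℚ · 1`. [cite: DeligneMilne1982Tannakian, II §6 Thm. 6.20]
[cite: MoonenZarhin1999LowDim, §2 (End⁰(X) = End_{Hg} H¹)] -/
theorem mem_bot_of_mem_center_endAlgebra (hX : IsSmoothProjective n X.X)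
    (hscalar : haveI := BettiUniverse.finite hX 1
      ∀ z' ∈ (BettiUniverse.hodge exists_isReal_hodgeModel_holds hX 1).endAlg,
        (∀ a ∈ (BettiUniverse.hodge exists_isReal_hodgeModel_holds hX 1).endAlg, z' * a = a * z') →
        ∃ q : ℚ, z' = q • 1)
    {z : X.endAlgebra} (hz : z ∈ Subalgebra.center ℚ X.endAlgebra) : z ∈ (⊥ : Subalgebra ℚ X.endAlgebra) := by
  have hn : X.dim = n := schemeDim_eq_holds hX
  subst hn
  haveI := BettiUniverse.finite hX 1
  rw [Subalgebra.mem_center_iff] at hz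
  have hz' : MulOpposite.unop (bettiRep X z) ∈ (BettiUniverse.hodge exists_isReal_hodgeModel_holds hX 1).endAlg :=
    unop_bettiRep_mem_endAlg exists_isReal_hodgeModel_holds hodgePQ_independent_of_hodgeModel_holds z
  have hcomm : ∀ a ∈ (BettiUniverse.hodge exists_isReal_hodgeModel_holds hX 1).endAlg,
      MulOpposite.unop (bettiRep X z) * a = a * MulOpposite.unop (bettiRep X z) := by
    intro a ha
    obtain ⟨u, k, hk, hu⟩ := exists_hom_bettiMap_eq_smul_of_mem_endAlg hX ha
    have hk' : (k : ℚ) ≠ 0 := by exact_mod_cast hk.ne'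
    -- `a = k⁻¹ • u^*` and `u^* = unop (bettiRep (of u))`
    have ha' : a = (k : ℚ)⁻¹ • MulOpposite.unop (bettiRep X (AbelianVariety.endAlgebra.of X (End.of u))) := by
      rw [bettiRep_of, MulOpposite.unop_op]
      change a = (k : ℚ)⁻¹ • (bettiCohomology.map u.hom.hom.hom 1).hom
      rw [hu, smul_smul, inv_mul_cancel₀ hk', one_smul]
    have hzu := hz (AbelianVariety.endAlgebra.of X (End.of u))
    have h := congrArg (fun w => MulOpposite.unop (bettiRep X w)) hzu
    simp only [map_mul, MulOpposite.unop_mul] at h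
    rw [ha', mul_smul_comm, smul_mul_assoc, h]
  obtain ⟨q, hq⟩ := hscalar _ hz' hcomm
  have hzq : bettiRep X z = bettiRep X (algebraMap ℚ X.endAlgebra q) := by
    rw [AlgHom.commutes, Algebra.algebraMap_eq_smul_one, ← MulOpposite.op_unop (bettiRep X z), hq,
      MulOpposite.op_smul, MulOpposite.op_one]
  rw [bettiRep_injective hzq]
  exact Subalgebra.algebraMap_mem _ q

end Bridge

/-! ## §2 Non-CM abelian varieties with `dim MT(H¹(X)) ≤ 4` -/

section RankFour

variable [HodgeTensorFacts.{0, 0}] {X : AbelianVariety ℂ} {n : ℕ}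

/-- **A complex abelian variety NOT of CM type with `dim MT(H¹(X)) ≤ 4` has `dim_ℚ End⁰(X) = (dim X)²`,
`dim MT(H¹(X)) = 4` and `dim Hg(H¹(X)) = 3`** (`0 < dim X`).  `H¹(X)` is a polarizable effective weight-one Hodge
structure which is not of CM type (`isOfCMType_iff_mumfordTateLieAlgebra_le_endAlg`), so
`Motives/HodgeLieWeightOneRankThree` gives `4 dim End_Hdg = (dim H¹)² = (2 dim X)²`, and `End⁰(X) ≅ End_Hdg(H¹X)`.
[cite: MoonenZarhin1999LowDim, §2] [cite: Deligne1982HodgeCycles, I Prop. 3.4 and §5 Prop. 5.1] -/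
theorem finrank_endAlgebra_eq_dim_sq_of_not_isOfCMType (hX : IsSmoothProjective n X.X) (h0 : 0 < X.dim)
    (hcm : ¬ IsOfCMType X)
    (h4 : haveI := BettiUniverse.finite hX 1
      (BettiUniverse.hodge exists_isReal_hodgeModel_holds hX 1).mtRank ≤ 4) :
    haveI := BettiUniverse.finite hX 1
    Module.finrank ℚ X.endAlgebra = X.dim ^ 2 ∧
      (BettiUniverse.hodge exists_isReal_hodgeModel_holds hX 1).mtRank = 4 ∧
      Module.finrank ℚ (BettiUniverse.hodge exists_isReal_hodgeModel_holds hX 1).hodgeLie = 3 := by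
  have hn : X.dim = n := schemeDim_eq_holds hX
  subst hn
  haveI := BettiUniverse.finite hX 1
  haveI := nontrivial_bettiCohomology_one h0
  set H := BettiUniverse.hodge exists_isReal_hodgeModel_holds hX 1 with hH
  obtain ⟨ψ⟩ := BettiUniverse.hodge_isPolarizable exists_isReal_hodgeModel_holds hX 1
  have hne : ¬ H.mumfordTateLieAlgebra ≤ Subalgebra.toSubmodule H.endAlg :=
    fun h => hcm ((isOfCMType_iff_mumfordTateLieAlgebra_le_endAlg hX).2 h)
  obtain ⟨h3, hmt, hsq⟩ := finrank_endAlg_of_mtRank_le_four H ψ (by simp) (BettiUniverse.hodge_isEffective _ hX 1)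
    hne h4
  refine ⟨?_, hmt, h3⟩
  rw [finrank_bettiCohomology_one, ← finrank_endAlgebra_eq_finrank_endAlg hX] at hsq
  have h : 4 * Module.finrank ℚ X.endAlgebra = 4 * X.dim ^ 2 := by rw [hsq]; ring
  omega

/-- **… and the centre of `End⁰(X)` is `ℚ`** (`Z(End_Hdg(H¹X)) = ℚ`, `exists_eq_smul_one_of_mem_center_endAlg_of_mtRank_le_four`,
transported by Riemann's theorem). [cite: MoonenZarhin1999LowDim, §2] [cite: DeligneMilne1982Tannakian, II §6 Thm. 6.20] -/
theorem center_endAlgebra_eq_bot_of_not_isOfCMType (hX : IsSmoothProjective n X.X) (h0 : 0 < X.dim)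
    (hcm : ¬ IsOfCMType X)
    (h4 : haveI := BettiUniverse.finite hX 1
      (BettiUniverse.hodge exists_isReal_hodgeModel_holds hX 1).mtRank ≤ 4) :
    Subalgebra.center ℚ X.endAlgebra = ⊥ := by
  have hn : X.dim = n := schemeDim_eq_holds hX
  subst hn
  haveI := BettiUniverse.finite hX 1
  haveI := nontrivial_bettiCohomology_one h0
  set H := BettiUniverse.hodge exists_isReal_hodgeModel_holds hX 1 with hH
  obtain ⟨ψ⟩ := BettiUniverse.hodge_isPolarizable exists_isReal_hodgeModel_holds hX 1
  have hne : ¬ H.mumfordTateLieAlgebra ≤ Subalgebra.toSubmodule H.endAlg :=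
    fun h => hcm ((isOfCMType_iff_mumfordTateLieAlgebra_le_endAlg hX).2 h)
  refine le_antisymm (fun z hz => ?_) bot_le
  exact mem_bot_of_mem_center_endAlgebra hX (fun z' hz' hzc =>
    exists_eq_smul_one_of_mem_center_endAlg_of_mtRank_le_four H ψ (by simp) (BettiUniverse.hodge_isEffective _ hX 1)
      hne h4 hz' hzc) hz

/-- `dim_ℚ Z(End⁰(X)) = 1` in the same situation. [cite: MoonenZarhin1999LowDim, §2] -/
theorem finrank_center_endAlgebra_eq_one_of_not_isOfCMType (hX : IsSmoothProjective n X.X) (h0 : 0 < X.dim)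
    (hcm : ¬ IsOfCMType X)
    (h4 : haveI := BettiUniverse.finite hX 1
      (BettiUniverse.hodge exists_isReal_hodgeModel_holds hX 1).mtRank ≤ 4) :
    Module.finrank ℚ (Subalgebra.center ℚ X.endAlgebra) = 1 := by
  haveI := nontrivial_endAlgebra_of_dim_pos (B := X) h0
  rw [center_endAlgebra_eq_bot_of_not_isOfCMType hX h0 hcm h4, Subalgebra.finrank_bot]

end RankFour

/-! ## §3 Isotypicity: `X ∼ B^{m+1}` with `B` simple, `Z(End⁰ B) = ℚ`, `(m+1)² dim End⁰(B) = (dim X)²` -/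

section Isotypic

variable [HodgeTensorFacts.{0, 0}] {X : AbelianVariety ℂ} {n : ℕ}

omit [HodgeTensorFacts.{0, 0}] in
/-- The centre of a non-zero finite-dimensional `ℚ`-algebra has positive dimension (`1 ≠ 0`). [folklore] -/
private theorem finrank_center_pos (R : Type*) [Ring R] [Algebra ℚ R] [Module.Finite ℚ R] [Nontrivial R] :
    0 < Module.finrank ℚ (Subalgebra.center ℚ R) := by
  haveI : Module.Finite ℚ (Subalgebra.center ℚ R) :=
    Module.Finite.of_injective (Subalgebra.center ℚ R).val.toLinearMap Subtype.val_injective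
  rw [Module.finrank_pos_iff_exists_ne_zero]
  exact ⟨⟨1, Subalgebra.one_mem _⟩, fun h => one_ne_zero (congrArg Subtype.val h)⟩

omit [HodgeTensorFacts.{0, 0}] in
/-- The centre of `End⁰` of a complex abelian variety of positive dimension has positive dimension (`1 ≠ 0`;
`End⁰(B)` is finite-dimensional, Mumford §19 Cor. 2 of Thm. 3). [cite: MumfordAV1970, §19 Thm. 3 Cor. 2] -/
theorem finrank_center_endAlgebra_pos {B : AbelianVariety ℂ} (hB : 0 < B.dim) :
    0 < Module.finrank ℚ (Subalgebra.center ℚ B.endAlgebra) := by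
  haveI := nontrivial_endAlgebra_of_dim_pos (B := B) hB
  haveI : Module.Finite ℚ B.endAlgebra := finiteDimensional_endAlgebra_holds B
  exact finrank_center_pos B.endAlgebra

omit [HodgeTensorFacts.{0, 0}] in
/-- **A complex abelian variety whose `End⁰` has centre `ℚ` is isotypic**: `X ∼ ⨁_{Fin (m+1)} B` with `B` simple of
positive dimension and `dim_ℚ Z(End⁰ B) = 1`, `dim X = (m + 1) dim B`, `dim_ℚ End⁰(X) = (m+1)² dim_ℚ End⁰(B)`.  In the
isotypic decomposition `X ∼ ⨁ᵢ Bᵢ^{nᵢ+1}` (`Motives/AbelianVarietyIsotypicDecomposition`) the centre of `End⁰(X) ≅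
⊕ᵢ M_{nᵢ+1}(End⁰ Bᵢ)` has dimension `Σᵢ dim Z(End⁰ Bᵢ) ≥ #{i}` (`CorCM/EndAlgebraCenterStructure`), so there is a single
isotypic component. [cite: MumfordAV1970, §19 Thm. 1 Cor. 1 and p. 174] [cite: MoonenZarhin1999LowDim, §2] -/
theorem exists_isIsogenous_power_of_finrank_center_eq_one
    (hZ : Module.finrank ℚ (Subalgebra.center ℚ X.endAlgebra) = 1) :
    ∃ (B : AbelianVariety ℂ) (m : ℕ), B.IsSimple ∧ 0 < B.dim ∧ IsIsogenous X (⨁ fun _ : Fin (m + 1) => B) ∧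
      X.dim = (m + 1) * B.dim ∧ Module.finrank ℚ X.endAlgebra = (m + 1) ^ 2 * Module.finrank ℚ B.endAlgebra ∧
      Module.finrank ℚ (Subalgebra.center ℚ B.endAlgebra) = 1 := by
  classical
  obtain ⟨r, B, nB, hS, hd, hni, hXB⟩ := exists_isIsogenous_biproduct_powers_fin X
  have horth := orthogonal_of_isSimple_of_not_isIsogenous hS hni
  obtain ⟨e⟩ := hXB.nonempty_endAlgebra_algEquiv
  have hZsum : Module.finrank ℚ (Subalgebra.center ℚ X.endAlgebra) =
      ∑ i, Module.finrank ℚ (Subalgebra.center ℚ (B i).endAlgebra) := by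
    rw [(IsotypicCM.center_transfer_algEquiv e).1, CMProductEnd.finrank_center_endAlgebra_biproduct_powers horth]
  -- exactly one isotypic component
  have hr1 : r = 1 := by
    have hle : r ≤ 1 := by
      have h := Finset.sum_le_sum fun i (_ : i ∈ (Finset.univ : Finset (Fin r))) =>
        Nat.one_le_iff_ne_zero.2 (finrank_center_endAlgebra_pos (hd i)).ne'
      rw [Finset.sum_const, Finset.card_univ, Fintype.card_fin, smul_eq_mul, mul_one, ← hZsum, hZ] at h
      exact h
    have hge : r ≠ 0 := by
      rintro rfl
      rw [hZsum, Finset.univ_eq_empty, Finset.sum_empty] at hZ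
      exact zero_ne_one hZ
    omega
  subst hr1
  -- `X ∼ ⨁_{Fin 1} (B 0)^{n+1} ≅ (B 0)^{n+1}`
  set m := nB 0 with hm
  let ι0 : (⨁ fun i : Fin 1 => ⨁ fun _ : Fin (nB i + 1) => B i) ≅ ⨁ fun _ : Fin (nB 0 + 1) => B 0 :=
    biproductUniqueIso (fun i : Fin 1 => ⨁ fun _ : Fin (nB i + 1) => B i)
  have hX0 : IsIsogenous X (⨁ fun _ : Fin (m + 1) => B 0) :=
    hXB.trans ⟨ι0.hom, isIsogeny_hom_of_iso ι0⟩
  obtain ⟨e0⟩ := hX0.nonempty_endAlgebra_algEquiv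
  have hZB : Module.finrank ℚ (Subalgebra.center ℚ (B 0).endAlgebra) = 1 :=
    ((EndAlgebraPower.finrank_center_endAlgebra_biproduct (B := B 0) (Nat.succ_pos m)).symm.trans
      (IsotypicCM.center_transfer_algEquiv e0).1.symm).trans hZ
  refine ⟨B 0, m, hS 0, hd 0, hX0, ?_, ?_, hZB⟩
  · obtain ⟨f, hf⟩ := hX0
    rw [dim_eq_of_isIsogeny hf, AndreRiemann.dim_biproduct_const]
  · rw [hX0.finrank_endAlgebra_eq, EndAlgebraPower.finrank_endAlgebra_biproduct]

/-- **Structure of complex abelian varieties NOT of CM type with `dim MT(H¹(X)) ≤ 4`** (`0 < dim X`): `X` is isogenous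
to a power `B^{m+1}` of ONE simple abelian variety `B`, itself not of CM type, with `Z(End⁰ B) = ℚ`,
`dim X = (m+1) dim B` and `(m+1)² · dim_ℚ End⁰(B) = (dim X)²`, i.e. `dim_ℚ End⁰(B) = (dim B)²`.  (Classically `B` is a
non-CM elliptic curve or a QM abelian surface — the abelian varieties with Hodge group `SL₂`; Albert's classification,
which would give `dim B ≤ 2`, is not used.) [cite: MoonenZarhin1999LowDim, §2] [cite: MumfordAV1970, §19 Thm. 1 Cor. 1 and p. 174] -/
theorem exists_isIsogenous_power_of_not_isOfCMType (hX : IsSmoothProjective n X.X) (h0 : 0 < X.dim)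
    (hcm : ¬ IsOfCMType X)
    (h4 : haveI := BettiUniverse.finite hX 1
      (BettiUniverse.hodge exists_isReal_hodgeModel_holds hX 1).mtRank ≤ 4) :
    ∃ (B : AbelianVariety ℂ) (m : ℕ), B.IsSimple ∧ 0 < B.dim ∧ ¬ IsOfCMType B ∧
      IsIsogenous X (⨁ fun _ : Fin (m + 1) => B) ∧ X.dim = (m + 1) * B.dim ∧
      Module.finrank ℚ B.endAlgebra = B.dim ^ 2 ∧ Module.finrank ℚ (Subalgebra.center ℚ B.endAlgebra) = 1 := by
  obtain ⟨hfin, -, -⟩ := finrank_endAlgebra_eq_dim_sq_of_not_isOfCMType hX h0 hcm h4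
  obtain ⟨B, m, hS, hB, hXB, hdim, hfinB, hZB⟩ := exists_isIsogenous_power_of_finrank_center_eq_one
    (finrank_center_endAlgebra_eq_one_of_not_isOfCMType hX h0 hcm h4)
  refine ⟨B, m, hS, hB, fun hBcm => hcm ?_, hXB, hdim, ?_, hZB⟩
  · rw [isOfCMType_iff_of_isIsogenous hXB, CMProductEnd.isOfCMType_biproduct_fin_iff]
    exact fun _ => hBcm
  · rw [hfin, hdim] at hfinB
    have h : (m + 1) ^ 2 * Module.finrank ℚ B.endAlgebra = (m + 1) ^ 2 * B.dim ^ 2 := by rw [← hfinB]; ring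
    exact Nat.eq_of_mul_eq_mul_left (by positivity) h

end Isotypic

/-! ## §4 `dim MT(H¹(X)) ≤ (2 dim X)²`; non-CM elliptic curves have `dim MT(H¹) = 4` and `End⁰ = ℚ` -/

section Elliptic

variable [HodgeTensorFacts.{0, 0}] {X : AbelianVariety ℂ} {n : ℕ}

/-- **`dim MT(H¹(X)) ≤ (2 dim X)²`**: `𝔪𝔱 ⊆ End_ℚ(H¹(X(ℂ); ℚ))`, of dimension `(2 dim X)²` (`b₁ = 2 dim X`).
[cite: Deligne1982HodgeCycles, I Prop. 3.4] [cite: MumfordAV1970, §1 (3)] -/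
theorem mtRank_hodge_one_le_sq (hX : IsSmoothProjective n X.X) :
    haveI := BettiUniverse.finite hX 1
    (BettiUniverse.hodge exists_isReal_hodgeModel_holds hX 1).mtRank ≤ (2 * X.dim) ^ 2 := by
  haveI := BettiUniverse.finite hX 1
  have h := Submodule.finrank_le (BettiUniverse.hodge exists_isReal_hodgeModel_holds hX 1).mumfordTateLieAlgebra
  rw [Module.finrank_linearMap, finrank_bettiCohomology_one, ← pow_two] at h
  exact h

/-- **A complex elliptic curve NOT of CM type has `dim MT(H¹(E)) = 4`** (`MT = GL₂`): `≥ 4` for non-CM varieties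
(`four_le_mtRank_hodge_one_of_not_isOfCMType`), `≤ (2 · 1)² = 4`. [cite: MoonenZarhin1999LowDim, §2]
[cite: Deligne1982HodgeCycles, I Ex. 3.7] -/
theorem mtRank_hodge_one_eq_four_of_dim_one (hX : IsSmoothProjective n X.X) (h1 : X.dim = 1) (hcm : ¬ IsOfCMType X) :
    haveI := BettiUniverse.finite hX 1
    (BettiUniverse.hodge exists_isReal_hodgeModel_holds hX 1).mtRank = 4 := by
  have hle := mtRank_hodge_one_le_sq hX
  have hge := four_le_mtRank_hodge_one_of_not_isOfCMType hX hcm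
  rw [h1] at hle
  exact le_antisymm hle hge

/-- **A complex elliptic curve NOT of CM type has `End⁰(E) = ℚ`**: `dim_ℚ End⁰(E) = (dim E)² = 1`, read off the
Mumford–Tate group (`finrank_endAlgebra_eq_dim_sq_of_not_isOfCMType`). [cite: MoonenZarhin1999LowDim, §2]
[cite: MumfordAV1970, §19 (p. 174) and §22] -/
theorem finrank_endAlgebra_eq_one_of_dim_one (hX : IsSmoothProjective n X.X) (h1 : X.dim = 1) (hcm : ¬ IsOfCMType X) :
    Module.finrank ℚ X.endAlgebra = 1 := by
  obtain ⟨h, -, -⟩ := finrank_endAlgebra_eq_dim_sq_of_not_isOfCMType hX (by omega) hcm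
    (mtRank_hodge_one_eq_four_of_dim_one hX h1 hcm).le
  rw [h, h1, one_pow]

end Elliptic

end Summit.HodgeConjecture.CorCM

end
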